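import Mathlib
import Summits.MatrixMultiplication.MatrixMultiplication.Theses.FidelityWitnesses
import Summits.MatrixMultiplication.MatrixMultiplication.Theorems.FidelityThesis.Negative.SummitEquivalence
import Summits.MatrixMultiplication.MatrixMultiplication.Theorems.FidelityWitnessesDiagonalPowerDecayGlue
import Summits.MatrixMultiplication.MatrixMultiplication.Theorems.FidelityWitnessesDiagonalPowerDecayBoxPattern
import Summits.MatrixMultiplication.MatrixMultiplication.Theorems.FidelityWitnessesDiagonalPowerDecayStubPartialMMCapacity
import Literature.Computability.AlgebraicComplexity.PartialMatrixMultiplication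
import Literature.Computability.AlgebraicComplexity.TensorRestrictionRank

/-!
# The exactness principle IS the capture-exponent law `M(n,n²) ≤ n^{6/ω+o(1)}`; it holds if `ω(ℂ) = 2`

Line `vertex-flattening-factor-rank` for the crux `FidelityWitnesses.DiagonalPowerDecay`
(`stmt-MatrixMultiplication-14053`), lead c2.  The reshaped skeleton
(`Cruxes/DiagonalPowerDecay/Lines/vertex_flattening_factor_rank.lean`) has the ω-free open stub

  `stub_exactnessIJ : ∀ ε>0 ∃ C>0 ∀ n≥1 ∀ S, R(S) ≤ n² → ∃ I J, R(⟨n,n,n⟩_{I,J}) ≤ n² ∧ |⟨S,T⟩|² ≤ C·n^ε·filling(I,J)·‖S‖²`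

("inexact L²-capture of `⟨n,n,n⟩` by `n²` multiplications never beats an EXACT partial matrix multiplication of the same
budget by a power of `n`").  This file pins down what it says and what it costs:

* `exactnessIJ_iff_captureLaw` — **the stub is EQUIVALENT to the CAPTURE-EXPONENT LAW**
  `CaptureLaw : ∀ ε>0 ∃ C>0 ∀ n≥1 ∀ S, R(S) ≤ n² → |⟨S,⟨n,n,n⟩⟩|² ≤ C·n^{6/ω(ℂ)+ε}·‖S‖²`,
  i.e. `M(n,n²) ≤ n^{6/ω+o(1)}`: rank-`n²` tensors capture no more of `⟨n,n,n⟩` than a zero-padded fast `⟨m,m,m⟩` does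
  (`m³ = n^{6/ω−o(1)}` units at rank `≤ n²`).  (⟹): Schönhage's capacity `filling ≤ n^{6/ω}` (landed `stub_partialMMCapacity`).
  (⟸): compare with the LARGEST BOX `□_m`, `R(⟨m,m,m⟩) ≤ n²` (`Nat.findGreatest`): it has rank `≤ n²`
  (`tensorRank_partialMatMulTensor_box_le_complex`) and filling `m³` (`filling_box`), and `m³ ≥ n^{6/(ω+θ)}/K` because
  `R(⟨m+1,m+1,m+1⟩) > n²` while `R(⟨a,a,a⟩) ≤ K₀ a^{ω+θ}` (`exists_tensorRank_matMulTensor_le_rpow`); `θ := ε/3` absorbs the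
  exponent loss `6/ω − 6/(ω+θ) ≤ 3θ/2`.  So the capture exponent `γ := lim log_n M(n,n²)` satisfies `6/ω ≤ γ ≤ 3`
  unconditionally, the crux says `γ < 3`, `ω > 2` says `6/ω < 3`, and the stub says `γ = 6/ω`.
* `captureLaw_of_omega_eq_two`, `exactnessIJ_of_omega_eq_two`, `exactnessIJ_of_matrixMultiplication`,
  `exactnessIJ_of_not_fidelityThesis` — if `ω(ℂ) = 2` the law is Cauchy–Schwarz (`|⟨S,T⟩|² ≤ n³‖S‖²`, `exIJ_overlap_sq_le`):
  the stub cannot be refuted without proving `ω(ℂ) > 2` (= the route target FidelityThesis, SummitEquivalence), and the two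
  open stubs of the skeleton (`stub_exactnessIJ`, `stub_twoLtOmega`) cannot both fail.
* `dpd_of_captureLaw_of_two_lt_omega`, `dpd_iff_fidelityThesis_of_captureLaw`, `matrixMultiplication_or_dpd_of_captureLaw` — the
  composition at Theorems level: under the law, crux #5 `DiagonalPowerDecay` and target #0 `FidelityThesis` COINCIDE, and the
  law itself implies `MatrixMultiplication ∨ DiagonalPowerDecay`.

Mathlib + landed Theorems (BoxPattern, StubPartialMMCapacity, SummitEquivalence, Glue) + Literature only; no definitions
(the two laws are written out in full in every signature).
-/

set_option linter.dupNamespace false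

namespace Summit.MatrixMultiplication.MatrixMultiplication.Theorems.DiagonalPowerDecay

open scoped BigOperators
open Literature.Computability.AlgebraicComplexity
open Summit.MatrixMultiplication.MatrixMultiplication.Theses.FidelityWitnesses (DiagonalPowerDecay FidelityThesis)

/-! ## Two elementary inequalities -/

/-- **Cauchy–Schwarz against `⟨n,n,n⟩`**: `|⟨S,T⟩|² ≤ n³·‖S‖²` for EVERY tensor `S` of the `n × n` format
(`‖T‖² = n³`). [folklore] -/
theorem exIJ_overlap_sq_le (n : ℕ) (S : (Fin n × Fin n) → (Fin n × Fin n) → (Fin n × Fin n) → ℂ) :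
    ‖∑ a, ∑ b, ∑ c, S a b c * matMulTensor ℂ n n n a b c‖ ^ 2 ≤
      (n : ℝ) ^ 3 * ∑ a, ∑ b, ∑ c, ‖S a b c‖ ^ 2 := by
  have h3c : ∀ g : (Fin n × Fin n) → (Fin n × Fin n) → (Fin n × Fin n) → ℂ,
      (∑ a, ∑ b, ∑ c, g a b c) =
        ∑ x : (Fin n × Fin n) × (Fin n × Fin n) × (Fin n × Fin n), g x.1 x.2.1 x.2.2 := by
    intro g; simp only [Fintype.sum_prod_type]
  have h3r : ∀ g : (Fin n × Fin n) → (Fin n × Fin n) → (Fin n × Fin n) → ℝ,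
      (∑ a, ∑ b, ∑ c, g a b c) =
        ∑ x : (Fin n × Fin n) × (Fin n × Fin n) × (Fin n × Fin n), g x.1 x.2.1 x.2.2 := by
    intro g; simp only [Fintype.sum_prod_type]
  rw [← Summit.MatrixMultiplication.MatrixMultiplication.Theorems.fidelityThesis_normSq_matMulTensor n,
    h3c, h3r (fun a b c => ‖S a b c‖ ^ 2), h3r (fun a b c => ‖matMulTensor ℂ n n n a b c‖ ^ 2)]
  calc ‖∑ x : (Fin n × Fin n) × (Fin n × Fin n) × (Fin n × Fin n),
          S x.1 x.2.1 x.2.2 * matMulTensor ℂ n n n x.1 x.2.1 x.2.2‖ ^ 2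
      ≤ (∑ x : (Fin n × Fin n) × (Fin n × Fin n) × (Fin n × Fin n),
          ‖S x.1 x.2.1 x.2.2‖ * ‖matMulTensor ℂ n n n x.1 x.2.1 x.2.2‖) ^ 2 := by
        gcongr
        exact (norm_sum_le _ _).trans (le_of_eq (Finset.sum_congr rfl fun x _ => norm_mul _ _))
    _ ≤ (∑ x : (Fin n × Fin n) × (Fin n × Fin n) × (Fin n × Fin n), ‖S x.1 x.2.1 x.2.2‖ ^ 2) *
          ∑ x : (Fin n × Fin n) × (Fin n × Fin n) × (Fin n × Fin n),
            ‖matMulTensor ℂ n n n x.1 x.2.1 x.2.2‖ ^ 2 :=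
        Finset.sum_mul_sq_le_sq_mul_sq _ _ _
    _ = _ := by ring

/-- **Exponent bookkeeping**: from `n² < K₁·m^p` (`p > 0`, `n ≥ 1`, `m > 0`) and `e₁ ≤ e + 6/p` conclude
`n^{e₁} ≤ n^e·K₁^{3/p}·m³` (raise to the power `3/p`: `n^{6/p} ≤ K₁^{3/p} m³`; then `n^{e₁} ≤ n^e·n^{6/p}`). [folklore] -/
theorem exIJ_core {p e₁ e K₁ n m : ℝ} (hp : 0 < p) (hn : 1 ≤ n) (hm : 0 < m) (hK : 0 < K₁)
    (hlt : n ^ 2 < K₁ * m ^ p) (he : e₁ ≤ e + 6 / p) :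
    n ^ e₁ ≤ n ^ e * (K₁ ^ (3 / p) * m ^ 3) := by
  have hq : 0 ≤ 3 / p := by positivity
  have hn0 : 0 < n := by linarith
  -- raise `hlt` to the power `3/p`
  have h1 : (n ^ 2) ^ (3 / p) ≤ (K₁ * m ^ p) ^ (3 / p) :=
    Real.rpow_le_rpow (by positivity) hlt.le hq
  have h2 : (n ^ 2 : ℝ) ^ (3 / p) = n ^ (6 / p) := by
    rw [← Real.rpow_natCast n 2, ← Real.rpow_mul hn0.le]
    congr 1
    push_cast
    ring
  have h3 : (K₁ * m ^ p) ^ (3 / p) = K₁ ^ (3 / p) * m ^ 3 := by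
    rw [Real.mul_rpow hK.le (Real.rpow_nonneg hm.le _), ← Real.rpow_mul hm.le]
    congr 1
    have ep : p * (3 / p) = ((3 : ℕ) : ℝ) := by
      push_cast
      field_simp
    rw [ep, Real.rpow_natCast]
  rw [h2, h3] at h1
  calc n ^ e₁ ≤ n ^ (e + 6 / p) := Real.rpow_le_rpow_of_exponent_le hn he
    _ = n ^ e * n ^ (6 / p) := Real.rpow_add hn0 _ _
    _ ≤ n ^ e * (K₁ ^ (3 / p) * m ^ 3) := mul_le_mul_of_nonneg_left h1 (Real.rpow_nonneg hn0.le _)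

/-! ## The exactness principle ⟺ the capture-exponent law `M(n,n²) ≤ n^{6/ω+o(1)}` -/

/-- **Capture law ⟹ exactness principle.** If rank-`n²` tensors capture at most `C_ε n^{6/ω+ε}` of `⟨n,n,n⟩`, then every such
`S` is matched, up to `C n^ε`, by the largest zero-padded box `⟨m,m,m⟩` of rank `≤ n²` (`filling = m³ ≥ n^{6/(ω+ε/3)}/K`).
[folklore] -/
theorem exactnessIJ_of_captureLaw
    (hL : ∀ ε : ℝ, 0 < ε → ∃ C : ℝ, 0 < C ∧ ∀ n : ℕ, 1 ≤ n →
      ∀ S : (Fin n × Fin n) → (Fin n × Fin n) → (Fin n × Fin n) → ℂ, tensorRank S ≤ n ^ 2 →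
        ‖∑ a, ∑ b, ∑ c, S a b c * matMulTensor ℂ n n n a b c‖ ^ 2 ≤
          C * (n : ℝ) ^ (6 / omega ℂ + ε) * ∑ a, ∑ b, ∑ c, ‖S a b c‖ ^ 2) :
    ∀ ε : ℝ, 0 < ε → ∃ C : ℝ, 0 < C ∧ ∀ n : ℕ, 1 ≤ n →
      ∀ S : (Fin n × Fin n) → (Fin n × Fin n) → (Fin n × Fin n) → ℂ, tensorRank S ≤ n ^ 2 →
        ∃ I J : Finset (Fin n × Fin n),
          tensorRank (partialMatMulTensor ℂ n n n I J) ≤ n ^ 2 ∧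
          ‖∑ a, ∑ b, ∑ c, S a b c * matMulTensor ℂ n n n a b c‖ ^ 2 ≤
            C * (n : ℝ) ^ ε * (filling n n n I J : ℝ) * ∑ a, ∑ b, ∑ c, ‖S a b c‖ ^ 2 := by
  classical
  intro ε hε
  have hω2 : 2 ≤ omega ℂ := omega_two_le ℂ
  have hω3 : omega ℂ ≤ 3 := omega_le_three' ℂ
  have hω0 : 0 < omega ℂ := by linarith
  -- the capture law at `ε/2`
  obtain ⟨C₀, hC₀, hL₀⟩ := hL (ε / 2) (half_pos hε)
  -- `ω` is an exponent: `R(⟨a,a,a⟩) ≤ K₀ a^{ω+θ}` for all `a ≥ 1`, `θ := ε/3`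
  set θ : ℝ := ε / 3 with hθ
  have hθ0 : 0 < θ := by positivity
  obtain ⟨K₀, hK₀, hR⟩ := exists_tensorRank_matMulTensor_le_rpow ℂ hθ0
  set p : ℝ := omega ℂ + θ with hpdef
  have hp0 : 0 < p := by positivity
  set K₁ : ℝ := K₀ * 2 ^ p with hK₁
  have hK₁0 : 0 < K₁ := by positivity
  -- the exponent loss `6/ω − 6/(ω+θ) ≤ ε/2`
  have hgap : 6 / omega ℂ + ε / 2 ≤ ε + 6 / p := by
    have h1 : 6 / omega ℂ - 6 / p = 6 * θ / (omega ℂ * p) := by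
      rw [hpdef]
      field_simp
      ring
    have h2 : 6 * θ / (omega ℂ * p) ≤ ε / 2 := by
      rw [div_le_iff₀ (by positivity)]
      have : (4 : ℝ) ≤ omega ℂ * p := by rw [hpdef]; nlinarith
      rw [hθ]
      nlinarith
    linarith
  refine ⟨max C₀ (C₀ * K₁ ^ (3 / p)), lt_max_of_lt_left hC₀, ?_⟩
  intro n hn S hS
  -- the largest box that fits the rank budget `n²`
  set m : ℕ := Nat.findGreatest (fun k => tensorRank (matMulTensor ℂ k k k) ≤ n ^ 2) n with hmdef
  have hP1 : tensorRank (matMulTensor ℂ 1 1 1) ≤ n ^ 2 :=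
    (tensorRank_matMulTensor_le (K := ℂ) 1 1 1).trans (by nlinarith)
  have hm1 : 1 ≤ m := Nat.le_findGreatest hn hP1
  have hmn : m ≤ n := Nat.findGreatest_le n
  have hPm : tensorRank (matMulTensor ℂ m m m) ≤ n ^ 2 :=
    Nat.findGreatest_spec (P := fun k => tensorRank (matMulTensor ℂ k k k) ≤ n ^ 2) hn hP1
  refine ⟨Finset.univ.filter fun q : Fin n × Fin n => (q.1 : ℕ) < m ∧ (q.2 : ℕ) < m,
    Finset.univ.filter fun q : Fin n × Fin n => (q.1 : ℕ) < m ∧ (q.2 : ℕ) < m,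
    (tensorRank_partialMatMulTensor_box_le_complex hmn).trans hPm, ?_⟩
  rw [filling_box hmn]
  push_cast
  have hcap := hL₀ n hn S hS
  have hNS : 0 ≤ ∑ a, ∑ b, ∑ c, ‖S a b c‖ ^ 2 := by positivity
  have hn1 : (1 : ℝ) ≤ n := by exact_mod_cast hn
  have hn0 : (0 : ℝ) < n := by positivity
  -- the arithmetic heart: `C₀ n^{6/ω+ε/2} ≤ C·n^ε·m³`
  have hcube : C₀ * (n : ℝ) ^ (6 / omega ℂ + ε / 2) ≤
      max C₀ (C₀ * K₁ ^ (3 / p)) * (n : ℝ) ^ ε * (m : ℝ) ^ 3 := by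
    by_cases hmeq : m = n
    · -- the whole format fits: `m = n`, `n^{6/ω+ε/2} ≤ n^{ε+3} = n^ε·n³`
      rw [hmeq]
      have h1 : (n : ℝ) ^ (6 / omega ℂ + ε / 2) ≤ (n : ℝ) ^ ε * (n : ℝ) ^ 3 := by
        have h6 : 6 / omega ℂ ≤ 3 := by rw [div_le_iff₀ hω0]; linarith
        calc (n : ℝ) ^ (6 / omega ℂ + ε / 2) ≤ (n : ℝ) ^ (ε + 3) :=
              Real.rpow_le_rpow_of_exponent_le hn1 (by linarith)
          _ = (n : ℝ) ^ ε * (n : ℝ) ^ ((3 : ℕ) : ℝ) := by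
              rw [← Real.rpow_add hn0]; push_cast; ring_nf
          _ = (n : ℝ) ^ ε * (n : ℝ) ^ 3 := by rw [Real.rpow_natCast]
      calc C₀ * (n : ℝ) ^ (6 / omega ℂ + ε / 2) ≤ C₀ * ((n : ℝ) ^ ε * (n : ℝ) ^ 3) :=
            mul_le_mul_of_nonneg_left h1 hC₀.le
        _ ≤ max C₀ (C₀ * K₁ ^ (3 / p)) * ((n : ℝ) ^ ε * (n : ℝ) ^ 3) :=
            mul_le_mul_of_nonneg_right (le_max_left _ _) (by positivity)
        _ = max C₀ (C₀ * K₁ ^ (3 / p)) * (n : ℝ) ^ ε * (n : ℝ) ^ 3 := by ring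
    · have hlt' : m < n := lt_of_le_of_ne hmn hmeq
      have hnot : ¬ tensorRank (matMulTensor ℂ (m + 1) (m + 1) (m + 1)) ≤ n ^ 2 :=
        Nat.findGreatest_is_greatest (P := fun k => tensorRank (matMulTensor ℂ k k k) ≤ n ^ 2)
          (Nat.lt_succ_self m) (Nat.succ_le_of_lt hlt')
      have hRm1 := hR (m + 1) (by omega)
      have hm0 : (0 : ℝ) < m := by exact_mod_cast hm1
      have hm1' : (1 : ℝ) ≤ m := by exact_mod_cast hm1
      have h2m : ((m + 1 : ℕ) : ℝ) ≤ 2 * m := by push_cast; linarith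
      have hchain : (n : ℝ) ^ 2 < K₁ * (m : ℝ) ^ p := by
        have h1 : ((n ^ 2 : ℕ) : ℝ) < (tensorRank (matMulTensor ℂ (m + 1) (m + 1) (m + 1)) : ℝ) := by
          exact_mod_cast (not_le.1 hnot)
        have h3 : ((m + 1 : ℕ) : ℝ) ^ p ≤ (2 * (m : ℝ)) ^ p :=
          Real.rpow_le_rpow (by positivity) h2m hp0.le
        have h4 : (2 * (m : ℝ)) ^ p = 2 ^ p * (m : ℝ) ^ p := Real.mul_rpow (by norm_num) hm0.le
        calc (n : ℝ) ^ 2 = ((n ^ 2 : ℕ) : ℝ) := by push_cast; ring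
          _ < _ := h1
          _ ≤ K₀ * ((m + 1 : ℕ) : ℝ) ^ p := hRm1
          _ ≤ K₀ * (2 * (m : ℝ)) ^ p := mul_le_mul_of_nonneg_left h3 hK₀.le
          _ = K₁ * (m : ℝ) ^ p := by rw [h4, hK₁]; ring
      have key := exIJ_core hp0 hn1 hm0 hK₁0 hchain hgap
      calc C₀ * (n : ℝ) ^ (6 / omega ℂ + ε / 2) ≤ C₀ * ((n : ℝ) ^ ε * (K₁ ^ (3 / p) * (m : ℝ) ^ 3)) :=
            mul_le_mul_of_nonneg_left key hC₀.le
        _ = (C₀ * K₁ ^ (3 / p)) * (n : ℝ) ^ ε * (m : ℝ) ^ 3 := by ring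
        _ ≤ max C₀ (C₀ * K₁ ^ (3 / p)) * (n : ℝ) ^ ε * (m : ℝ) ^ 3 := by
            gcongr
            exact le_max_right _ _
  calc ‖∑ a, ∑ b, ∑ c, S a b c * matMulTensor ℂ n n n a b c‖ ^ 2
      ≤ C₀ * (n : ℝ) ^ (6 / omega ℂ + ε / 2) * ∑ a, ∑ b, ∑ c, ‖S a b c‖ ^ 2 := hcap
    _ ≤ (max C₀ (C₀ * K₁ ^ (3 / p)) * (n : ℝ) ^ ε * (m : ℝ) ^ 3) * ∑ a, ∑ b, ∑ c, ‖S a b c‖ ^ 2 :=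
        mul_le_mul_of_nonneg_right hcube hNS
    _ = max C₀ (C₀ * K₁ ^ (3 / p)) * (n : ℝ) ^ ε * (m : ℝ) ^ 3 * ∑ a, ∑ b, ∑ c, ‖S a b c‖ ^ 2 := by
        ring

/-- **Exactness principle ⟹ capture law** (by Schönhage's capacity bound, landed `stub_partialMMCapacity`:
`filling ≤ n^{6/ω}` at rank `≤ n²`). [folklore] -/
theorem captureLaw_of_exactnessIJ
    (hE : ∀ ε : ℝ, 0 < ε → ∃ C : ℝ, 0 < C ∧ ∀ n : ℕ, 1 ≤ n →
      ∀ S : (Fin n × Fin n) → (Fin n × Fin n) → (Fin n × Fin n) → ℂ, tensorRank S ≤ n ^ 2 →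
        ∃ I J : Finset (Fin n × Fin n),
          tensorRank (partialMatMulTensor ℂ n n n I J) ≤ n ^ 2 ∧
          ‖∑ a, ∑ b, ∑ c, S a b c * matMulTensor ℂ n n n a b c‖ ^ 2 ≤
            C * (n : ℝ) ^ ε * (filling n n n I J : ℝ) * ∑ a, ∑ b, ∑ c, ‖S a b c‖ ^ 2) :
    ∀ ε : ℝ, 0 < ε → ∃ C : ℝ, 0 < C ∧ ∀ n : ℕ, 1 ≤ n →
      ∀ S : (Fin n × Fin n) → (Fin n × Fin n) → (Fin n × Fin n) → ℂ, tensorRank S ≤ n ^ 2 →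
        ‖∑ a, ∑ b, ∑ c, S a b c * matMulTensor ℂ n n n a b c‖ ^ 2 ≤
          C * (n : ℝ) ^ (6 / omega ℂ + ε) * ∑ a, ∑ b, ∑ c, ‖S a b c‖ ^ 2 := by
  intro ε hε
  obtain ⟨C, hC, hEC⟩ := hE ε hε
  refine ⟨C, hC, fun n hn S hS => ?_⟩
  obtain ⟨I, J, hIJ, hcmp⟩ := hEC n hn S hS
  have hcap := stub_partialMMCapacity n I J hIJ
  have hn0 : (0 : ℝ) < n := by exact_mod_cast hn
  calc ‖∑ a, ∑ b, ∑ c, S a b c * matMulTensor ℂ n n n a b c‖ ^ 2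
      ≤ C * (n : ℝ) ^ ε * (filling n n n I J : ℝ) * ∑ a, ∑ b, ∑ c, ‖S a b c‖ ^ 2 := hcmp
    _ ≤ C * (n : ℝ) ^ ε * (n : ℝ) ^ (6 / omega ℂ) * ∑ a, ∑ b, ∑ c, ‖S a b c‖ ^ 2 := by gcongr
    _ = C * (n : ℝ) ^ (6 / omega ℂ + ε) * ∑ a, ∑ b, ∑ c, ‖S a b c‖ ^ 2 := by
        rw [Real.rpow_add hn0]; ring

/-- **The exactness principle IS the capture-exponent law**: `stub_exactnessIJ ⟺ (M(n,n²) ≤ C_ε·n^{6/ω(ℂ)+ε})`.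
Rank-`n²` tensors capture at most `n^{6/ω+o(1)}` of `⟨n,n,n⟩` — exactly what a zero-padded fast `⟨m,m,m⟩` captures —
if and only if inexact capture never beats exact partial matrix multiplication by a power of `n`. [folklore] -/
theorem exactnessIJ_iff_captureLaw :
    (∀ ε : ℝ, 0 < ε → ∃ C : ℝ, 0 < C ∧ ∀ n : ℕ, 1 ≤ n →
      ∀ S : (Fin n × Fin n) → (Fin n × Fin n) → (Fin n × Fin n) → ℂ, tensorRank S ≤ n ^ 2 →
        ∃ I J : Finset (Fin n × Fin n),
          tensorRank (partialMatMulTensor ℂ n n n I J) ≤ n ^ 2 ∧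
          ‖∑ a, ∑ b, ∑ c, S a b c * matMulTensor ℂ n n n a b c‖ ^ 2 ≤
            C * (n : ℝ) ^ ε * (filling n n n I J : ℝ) * ∑ a, ∑ b, ∑ c, ‖S a b c‖ ^ 2) ↔
    (∀ ε : ℝ, 0 < ε → ∃ C : ℝ, 0 < C ∧ ∀ n : ℕ, 1 ≤ n →
      ∀ S : (Fin n × Fin n) → (Fin n × Fin n) → (Fin n × Fin n) → ℂ, tensorRank S ≤ n ^ 2 →
        ‖∑ a, ∑ b, ∑ c, S a b c * matMulTensor ℂ n n n a b c‖ ^ 2 ≤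
          C * (n : ℝ) ^ (6 / omega ℂ + ε) * ∑ a, ∑ b, ∑ c, ‖S a b c‖ ^ 2) :=
  ⟨captureLaw_of_exactnessIJ, exactnessIJ_of_captureLaw⟩

/-! ## `ω(ℂ) = 2` gives the law (Cauchy–Schwarz), hence the stub -/

/-- **If `ω(ℂ) = 2` the capture law is Cauchy–Schwarz** (`|⟨S,T⟩|² ≤ n³‖S‖² = n^{6/2}‖S‖² ≤ n^{6/ω+ε}‖S‖²`). [folklore] -/
theorem captureLaw_of_omega_eq_two (hω : omega ℂ = 2) :
    ∀ ε : ℝ, 0 < ε → ∃ C : ℝ, 0 < C ∧ ∀ n : ℕ, 1 ≤ n →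
      ∀ S : (Fin n × Fin n) → (Fin n × Fin n) → (Fin n × Fin n) → ℂ, tensorRank S ≤ n ^ 2 →
        ‖∑ a, ∑ b, ∑ c, S a b c * matMulTensor ℂ n n n a b c‖ ^ 2 ≤
          C * (n : ℝ) ^ (6 / omega ℂ + ε) * ∑ a, ∑ b, ∑ c, ‖S a b c‖ ^ 2 := by
  intro ε hε
  refine ⟨1, one_pos, fun n hn S _ => ?_⟩
  have hn1 : (1 : ℝ) ≤ n := by exact_mod_cast hn
  have hn0 : (0 : ℝ) < n := by positivity
  have h3 : (n : ℝ) ^ 3 ≤ (n : ℝ) ^ (6 / omega ℂ + ε) := by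
    rw [hω, ← Real.rpow_natCast (n : ℝ) 3]
    exact Real.rpow_le_rpow_of_exponent_le hn1 (by norm_num; linarith)
  calc ‖∑ a, ∑ b, ∑ c, S a b c * matMulTensor ℂ n n n a b c‖ ^ 2
      ≤ (n : ℝ) ^ 3 * ∑ a, ∑ b, ∑ c, ‖S a b c‖ ^ 2 := exIJ_overlap_sq_le n S
    _ ≤ 1 * (n : ℝ) ^ (6 / omega ℂ + ε) * ∑ a, ∑ b, ∑ c, ‖S a b c‖ ^ 2 := by
        rw [one_mul]
        exact mul_le_mul_of_nonneg_right h3 (by positivity)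

/-- **`ω(ℂ) = 2` implies the exactness principle `stub_exactnessIJ`** (registered sub-goal of stmt-MatrixMultiplication-14053):
the ω-free stub of line `vertex-flattening-factor-rank` cannot be refuted without proving `ω(ℂ) > 2`. [folklore] -/
theorem exactnessIJ_of_omega_eq_two (hω : omega ℂ = 2) :
    ∀ ε : ℝ, 0 < ε → ∃ C : ℝ, 0 < C ∧ ∀ n : ℕ, 1 ≤ n →
      ∀ S : (Fin n × Fin n) → (Fin n × Fin n) → (Fin n × Fin n) → ℂ, tensorRank S ≤ n ^ 2 →
        ∃ I J : Finset (Fin n × Fin n),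
          tensorRank (partialMatMulTensor ℂ n n n I J) ≤ n ^ 2 ∧
          ‖∑ a, ∑ b, ∑ c, S a b c * matMulTensor ℂ n n n a b c‖ ^ 2 ≤
            C * (n : ℝ) ^ ε * (filling n n n I J : ℝ) * ∑ a, ∑ b, ∑ c, ‖S a b c‖ ^ 2 :=
  exactnessIJ_of_captureLaw (captureLaw_of_omega_eq_two hω)

/-- **The summit implies the exactness principle**: `MatrixMultiplication` (`ω(ℂ) = 2`) gives `stub_exactnessIJ`.
[folklore] -/
theorem exactnessIJ_of_matrixMultiplication (hM : _root_.MatrixMultiplication) :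
    ∀ ε : ℝ, 0 < ε → ∃ C : ℝ, 0 < C ∧ ∀ n : ℕ, 1 ≤ n →
      ∀ S : (Fin n × Fin n) → (Fin n × Fin n) → (Fin n × Fin n) → ℂ, tensorRank S ≤ n ^ 2 →
        ∃ I J : Finset (Fin n × Fin n),
          tensorRank (partialMatMulTensor ℂ n n n I J) ≤ n ^ 2 ∧
          ‖∑ a, ∑ b, ∑ c, S a b c * matMulTensor ℂ n n n a b c‖ ^ 2 ≤
            C * (n : ℝ) ^ ε * (filling n n n I J : ℝ) * ∑ a, ∑ b, ∑ c, ‖S a b c‖ ^ 2 :=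
  exactnessIJ_of_omega_eq_two (_root_.MatrixMultiplication_iff.1 hM)

/-- **A failure of the route target also implies the exactness principle** (`¬FidelityThesis ⟹ ω(ℂ) = 2`,
`omega_eq_two_of_not_fidelityThesis`): the two open stubs of the reshaped skeleton — `stub_exactnessIJ` and
`stub_twoLtOmega` (⟺ FidelityThesis) — cannot both fail. [folklore] -/
theorem exactnessIJ_of_not_fidelityThesis (hX : ¬ FidelityThesis) :
    ∀ ε : ℝ, 0 < ε → ∃ C : ℝ, 0 < C ∧ ∀ n : ℕ, 1 ≤ n →
      ∀ S : (Fin n × Fin n) → (Fin n × Fin n) → (Fin n × Fin n) → ℂ, tensorRank S ≤ n ^ 2 →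
        ∃ I J : Finset (Fin n × Fin n),
          tensorRank (partialMatMulTensor ℂ n n n I J) ≤ n ^ 2 ∧
          ‖∑ a, ∑ b, ∑ c, S a b c * matMulTensor ℂ n n n a b c‖ ^ 2 ≤
            C * (n : ℝ) ^ ε * (filling n n n I J : ℝ) * ∑ a, ∑ b, ∑ c, ‖S a b c‖ ^ 2 :=
  exactnessIJ_of_omega_eq_two
    (Summit.MatrixMultiplication.MatrixMultiplication.Theorems.omega_eq_two_of_not_fidelityThesis hX)

/-! ## Under the law, crux #5 and target #0 coincide -/

/-- **Capture law ∧ `ω(ℂ) > 2` ⟹ the crux** (the skeleton's composition at Theorems level, with the two open stubs as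
hypotheses): `η := (3 − 6/ω)/2 > 0`, and the law at `ε := η` gives `|⟨S,T⟩|² ≤ C n^{6/ω+η}‖S‖² = C n^{3−2(η/2)}‖S‖²`.
[folklore] -/
theorem dpd_of_captureLaw_of_two_lt_omega
    (hL : ∀ ε : ℝ, 0 < ε → ∃ C : ℝ, 0 < C ∧ ∀ n : ℕ, 1 ≤ n →
      ∀ S : (Fin n × Fin n) → (Fin n × Fin n) → (Fin n × Fin n) → ℂ, tensorRank S ≤ n ^ 2 →
        ‖∑ a, ∑ b, ∑ c, S a b c * matMulTensor ℂ n n n a b c‖ ^ 2 ≤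
          C * (n : ℝ) ^ (6 / omega ℂ + ε) * ∑ a, ∑ b, ∑ c, ‖S a b c‖ ^ 2)
    (hω : 2 < omega ℂ) : DiagonalPowerDecay := by
  have hωpos : 0 < omega ℂ := by linarith
  have hlt : 6 / omega ℂ < 3 := by
    rw [div_lt_iff₀ hωpos]; linarith
  set η : ℝ := (3 - 6 / omega ℂ) / 2 with hη
  have hη0 : 0 < η := by rw [hη]; linarith
  obtain ⟨C, _, hLC⟩ := hL η hη0
  refine ⟨C, η / 2, by linarith, ?_⟩
  intro n S hS
  rcases Nat.eq_zero_or_pos n with rfl | hn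
  · simp
  · have hexp : 6 / omega ℂ + η = 3 - 2 * (η / 2) := by rw [hη]; ring
    have h := hLC n hn S hS
    rwa [hexp] at h

/-- **Under the capture law, `DiagonalPowerDecay ⟺ FidelityThesis`**: crux #5 carries no surcharge over the route target
(`⟹`: landed glue `diagonalPowerDecayGlue_proof`; `⟸`: `two_lt_omega_of_fidelityThesis` + `dpd_of_captureLaw_of_two_lt_omega`).
[folklore] -/
theorem dpd_iff_fidelityThesis_of_captureLaw
    (hL : ∀ ε : ℝ, 0 < ε → ∃ C : ℝ, 0 < C ∧ ∀ n : ℕ, 1 ≤ n →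
      ∀ S : (Fin n × Fin n) → (Fin n × Fin n) → (Fin n × Fin n) → ℂ, tensorRank S ≤ n ^ 2 →
        ‖∑ a, ∑ b, ∑ c, S a b c * matMulTensor ℂ n n n a b c‖ ^ 2 ≤
          C * (n : ℝ) ^ (6 / omega ℂ + ε) * ∑ a, ∑ b, ∑ c, ‖S a b c‖ ^ 2) :
    DiagonalPowerDecay ↔ FidelityThesis :=
  ⟨fun hD => Summit.MatrixMultiplication.MatrixMultiplication.Theorems.diagonalPowerDecayGlue_proof hD,
    fun hX => dpd_of_captureLaw_of_two_lt_omega hL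
      (Summit.MatrixMultiplication.MatrixMultiplication.Theorems.two_lt_omega_of_fidelityThesis hX)⟩

/-- **The capture law implies `MatrixMultiplication ∨ DiagonalPowerDecay`** (case `ω = 2`: the summit; case `ω > 2`: the
crux). Conversely `MatrixMultiplication` implies the law (`captureLaw_of_omega_eq_two`). [folklore] -/
theorem matrixMultiplication_or_dpd_of_captureLaw
    (hL : ∀ ε : ℝ, 0 < ε → ∃ C : ℝ, 0 < C ∧ ∀ n : ℕ, 1 ≤ n →
      ∀ S : (Fin n × Fin n) → (Fin n × Fin n) → (Fin n × Fin n) → ℂ, tensorRank S ≤ n ^ 2 →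
        ‖∑ a, ∑ b, ∑ c, S a b c * matMulTensor ℂ n n n a b c‖ ^ 2 ≤
          C * (n : ℝ) ^ (6 / omega ℂ + ε) * ∑ a, ∑ b, ∑ c, ‖S a b c‖ ^ 2) :
    _root_.MatrixMultiplication ∨ DiagonalPowerDecay := by
  by_cases hM : _root_.MatrixMultiplication
  · exact Or.inl hM
  · refine Or.inr (dpd_of_captureLaw_of_two_lt_omega hL ?_)
    rw [_root_.MatrixMultiplication_iff] at hM
    exact lt_of_le_of_ne (omega_two_le ℂ) (Ne.symm hM)

end Summit.MatrixMultiplication.MatrixMultiplication.Theorems.DiagonalPowerDecay
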